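import Mathlib
import HarnessLib
import HarnessLib.Audit
import Summits.ValiantsHypothesis.ValiantsHypothesis.Theorems.LacunarySymmetroidMatrixDescartesZeroChangeValleyDipCore

/-!
# ValiantsHypothesis / LacunarySymmetroid — crux `MatrixDescartes` (stmt-ValiantsHypothesis-18050, V1), LINE (A) «product_plus_one»,
# research stubs `stub_classRowK3` / `stub_eulerBoundK3`, valley residue: the DIP-ADMISSIBLE WINDOW LAW
# (`S/t^{c−1}` is increasing where `Σ_j h_j² < a(a−c)·M`; at most ONE critical point per admissible window)

Sixth panel of the valley-residue series (✓ `…ZeroChangeValleyBottoms`, ✓ `…EulerMiddleOuterRatio`, ✓ `…EulerTopBottomRatio`,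
✓ `…ZeroChangeValleyDipBudget`, ⧗ `…ZeroChangeValleyDipCore`).  For a company `Φ = ∏_j g_j` of trinomial rows on `0 < a < c` let
`S(t) = Σ_j g_j′(t)/g_j(t)` (so `Φ′ = Φ·S` off the roots), `h_j = t g_j′/g_j`, `M` the middle Pick sum ✓ `middleSum`.  The identity behind
✓ `concavity_identity`, taken OFF the critical points, reads
  `t²·S′(t) − (c−1)·t·S(t) = a(a−c)·M(t) − Σ_j h_j(t)²`                                   (`sq_mul_deriv_logDeriv_identity`),
i.e. `(S/t^{c−1})′ = t^{−c}·(a(a−c)M − Σ_j h_j²)`.  Hence on a window `[u,v] ⊂ (0,∞)` free of roots on which the DIP CRITERION of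
✓ `dip_iff_sq_sum_le` holds STRICTLY at every point (`Σ_j h_j² < a(a−c)M` — the window is «dip-admissible»; for valley companies `M < 0` and the
right side is `a(c−a)|M| > 0`), the function `S/t^{c−1}` is strictly increasing, so `Φ` has AT MOST ONE critical point there, and that point
is a dip:

* `hasDerivAt_logDerivSum` / `sq_mul_deriv_logDeriv_identity` — calculus of `S` (any letters, off the roots);
* ★★ `card_crit_Icc_le_one_of_dipAdmissible` — the window law (any company, any letters; hypotheses: rows non-vanishing on `[u,v]`, `0 < u`,
  strict dip criterion on `[u,v]`);
* `valley_dips_separated` — corollary: two distinct dips of a zero-free company are separated by a point at which the dip criterion FAILS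
  (`a(a−c)M ≤ Σ_j h_j²`), i.e. the dips lie in distinct components of the admissible set `A = {Σ_j h_j² < a(a−c)M}`.

So the located count `#DIPS ≤ m` (✓ `…ValleyDipBudget` header; seat numerics also give: `A` has at most `m + 1` components, the first one
dip-free) is EQUIVALENT to a bound on the number of components of `A` that carry a critical point.  This is the valley-side twin of the
floor's ✓ `card_crit_Ioo_le_one_of_middleSum_pos` (there `M > 0` at the critical points of a root-free window ⇒ ≤ 1 critical point).

HONEST FRAMING: helper theorems, def-free, no named facts, no `sorry`, standard axioms; closes NO stub by name; `OneChangeFloorK3`,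
`EulerBoundK3`, `ClassRowK3Linear`, `PPOPolyLaw`, `MatrixDescartes` (stmt-ValiantsHypothesis-18050) stay OPEN; `VP ≠ VNP` is NOT proved and
nothing here bears on it.  [folklore] One-variable calculus; no citation needed.
-/

set_option linter.dupNamespace false

namespace Summit.ValiantsHypothesis.ValiantsHypothesis.Theorems.LacunarySymmetroidMatrixDescartes

namespace ZeroChange

open Polynomial Finset

/-! ## §1 Calculus of the logarithmic-derivative sum `S = Σ_j g_j′/g_j` -/

/-- Derivative of `S(t) = Σ_j g_j′(t)/g_j(t)` at a point where no row vanishes. [folklore] -/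
theorem hasDerivAt_logDerivSum (m a c : ℕ) (co : Fin m → ℝ × ℝ × ℝ) {t : ℝ}
    (hg : ∀ j, (row a c (co j).1 (co j).2.1 (co j).2.2).eval t ≠ 0) :
    HasDerivAt (fun x => ∑ j, (derivative (row a c (co j).1 (co j).2.1 (co j).2.2)).eval x /
        (row a c (co j).1 (co j).2.1 (co j).2.2).eval x)
      (∑ j, ((derivative (derivative (row a c (co j).1 (co j).2.1 (co j).2.2))).eval t *
          (row a c (co j).1 (co j).2.1 (co j).2.2).eval t -
        (derivative (row a c (co j).1 (co j).2.1 (co j).2.2)).eval t *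
          (derivative (row a c (co j).1 (co j).2.1 (co j).2.2)).eval t) /
        ((row a c (co j).1 (co j).2.1 (co j).2.2).eval t) ^ 2) t := by
  refine HasDerivAt.fun_sum fun j _ => ?_
  exact ((derivative (row a c (co j).1 (co j).2.1 (co j).2.2)).hasDerivAt t).fun_div
    ((row a c (co j).1 (co j).2.1 (co j).2.2).hasDerivAt t) (hg j)

/-- ★ **THE IDENTITY** `t²·S′(t) − (c−1)·t·S(t) = a(a−c)·M(t) − Σ_j (t g_j′(t)/g_j(t))²` (any letters, off the roots). [folklore] -/
theorem sq_mul_deriv_logDeriv_identity (m a c : ℕ) (co : Fin m → ℝ × ℝ × ℝ) {t : ℝ}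
    (hg : ∀ j, (row a c (co j).1 (co j).2.1 (co j).2.2).eval t ≠ 0) :
    t ^ 2 * (∑ j, ((derivative (derivative (row a c (co j).1 (co j).2.1 (co j).2.2))).eval t *
          (row a c (co j).1 (co j).2.1 (co j).2.2).eval t -
        (derivative (row a c (co j).1 (co j).2.1 (co j).2.2)).eval t *
          (derivative (row a c (co j).1 (co j).2.1 (co j).2.2)).eval t) /
        ((row a c (co j).1 (co j).2.1 (co j).2.2).eval t) ^ 2)
      - ((c : ℝ) - 1) * t * ∑ j, (derivative (row a c (co j).1 (co j).2.1 (co j).2.2)).eval t /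
        (row a c (co j).1 (co j).2.1 (co j).2.2).eval t
      = (a : ℝ) * ((a : ℝ) - c) * middleSum a c co t -
        ∑ j, (t * (derivative (row a c (co j).1 (co j).2.1 (co j).2.2)).eval t /
          (row a c (co j).1 (co j).2.1 (co j).2.2).eval t) ^ 2 := by
  classical
  rw [middleSum, mul_sum, mul_sum, mul_sum, ← sum_sub_distrib, ← sum_sub_distrib]
  refine sum_congr rfl fun j _ => ?_
  set G := (row a c (co j).1 (co j).2.1 (co j).2.2).eval t with hG
  set D1 := (derivative (row a c (co j).1 (co j).2.1 (co j).2.2)).eval t with hD1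
  set D2 := (derivative (derivative (row a c (co j).1 (co j).2.1 (co j).2.2))).eval t with hD2
  have hP : t * D1 = (a : ℝ) * (co j).2.1 * t ^ a + (c : ℝ) * (co j).2.2 * t ^ c := mul_eval_derivative_row a c _ _ _ t
  have hQ : t ^ 2 * D2 = ((a : ℝ) ^ 2 - a) * (co j).2.1 * t ^ a + ((c : ℝ) ^ 2 - c) * (co j).2.2 * t ^ c :=
    sq_mul_eval_derivative2_row a c _ _ _ t
  have hGv : G = (co j).1 + (co j).2.1 * t ^ a + (co j).2.2 * t ^ c := eval_row a c _ _ _ t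
  have hGne : G ≠ 0 := hg j
  -- clear denominators
  have e1 : t ^ 2 * ((D2 * G - D1 * D1) / G ^ 2) - ((c : ℝ) - 1) * t * (D1 / G)
      = ((t ^ 2 * D2) * G - (t * D1) * (t * D1) - ((c : ℝ) - 1) * (t * D1) * G) / G ^ 2 := by
    field_simp
  have e2 : (a : ℝ) * ((a : ℝ) - c) * ((co j).2.1 * t ^ a / G) - (t * D1 / G) ^ 2
      = ((a : ℝ) * ((a : ℝ) - c) * (co j).2.1 * t ^ a * G - (t * D1) * (t * D1)) / G ^ 2 := by
    field_simp
  rw [e1, e2, hP, hQ]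
  congr 1
  rw [hGv]
  ring

/-! ## §2 The window law -/

/-- ★★ **DIP-ADMISSIBLE WINDOW LAW**: on a window `[u, v] ⊂ (0,∞)` on which no row vanishes and the strict dip criterion
`Σ_j (t g_j′/g_j)² < a(a−c)·M(t)` holds at every point, `Φ = ∏_j g_j` has at most ONE critical point (`S/t^{c−1}` is strictly
increasing there).  Any letters. [folklore] -/
theorem card_crit_Icc_le_one_of_dipAdmissible (m a c : ℕ) (hc : 1 ≤ c) (co : Fin m → ℝ × ℝ × ℝ) {u v : ℝ} (hu : 0 < u)
    (hg : ∀ t ∈ Set.Icc u v, ∀ j, (row a c (co j).1 (co j).2.1 (co j).2.2).eval t ≠ 0)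
    (hadm : ∀ t ∈ Set.Icc u v,
      ∑ j, (t * (derivative (row a c (co j).1 (co j).2.1 (co j).2.2)).eval t /
          (row a c (co j).1 (co j).2.1 (co j).2.2).eval t) ^ 2 < (a : ℝ) * ((a : ℝ) - c) * middleSum a c co t) :
    (((derivative (∏ j, row a c (co j).1 (co j).2.1 (co j).2.2)).roots.toFinset).filter
        (fun t => u ≤ t ∧ t ≤ v)).card ≤ 1 := by
  classical
  set Φ : ℝ[X] := ∏ j, row a c (co j).1 (co j).2.1 (co j).2.2 with hΦ
  -- the logarithmic-derivative sum and the monotone function R = S / t^(c-1)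
  set S : ℝ → ℝ := fun x => ∑ j, (derivative (row a c (co j).1 (co j).2.1 (co j).2.2)).eval x /
      (row a c (co j).1 (co j).2.1 (co j).2.2).eval x with hS
  set R : ℝ → ℝ := fun x => S x / x ^ (c - 1) with hR
  -- derivative of R on the window and its sign
  have hRderiv : ∀ t ∈ Set.Icc u v, ∃ R' : ℝ, HasDerivAt R R' t ∧ 0 < R' := by
    intro t ht
    have ht0 : 0 < t := hu.trans_le ht.1
    have hgt := hg t ht
    obtain hSd := hasDerivAt_logDerivSum m a c co hgt
    set S' := ∑ j, ((derivative (derivative (row a c (co j).1 (co j).2.1 (co j).2.2))).eval t *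
          (row a c (co j).1 (co j).2.1 (co j).2.2).eval t -
        (derivative (row a c (co j).1 (co j).2.1 (co j).2.2)).eval t *
          (derivative (row a c (co j).1 (co j).2.1 (co j).2.2)).eval t) /
        ((row a c (co j).1 (co j).2.1 (co j).2.2).eval t) ^ 2 with hS'
    have hpow : HasDerivAt (fun x : ℝ => x ^ (c - 1)) (((c - 1 : ℕ) : ℝ) * t ^ (c - 1 - 1)) t := hasDerivAt_pow (c - 1) t
    have htc : t ^ (c - 1) ≠ 0 := pow_ne_zero _ ht0.ne'
    have hRd : HasDerivAt R ((S' * t ^ (c - 1) - S t * (((c - 1 : ℕ) : ℝ) * t ^ (c - 1 - 1))) / (t ^ (c - 1)) ^ 2) t :=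
      hSd.div hpow htc
    refine ⟨_, hRd, ?_⟩
    -- sign: numerator = t^(c-2) · (t S' − (c−1) S) and t·(t S' − (c−1) S) = a(a−c)M − Σ h² > 0
    have hid := sq_mul_deriv_logDeriv_identity m a c co hgt
    have hkey : 0 < t ^ 2 * S' - ((c : ℝ) - 1) * t * S t := by
      rw [hid]
      linarith [hadm t ht]
    have hcast : (((c - 1 : ℕ) : ℝ)) = (c : ℝ) - 1 := by
      rw [Nat.cast_sub hc, Nat.cast_one]
    have hnum : (S' * t ^ (c - 1) - S t * (((c - 1 : ℕ) : ℝ) * t ^ (c - 1 - 1))) * t ^ 2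
        = (t ^ 2 * S' - ((c : ℝ) - 1) * t * S t) * t ^ (c - 1) := by
      rw [hcast]
      rcases Nat.lt_or_ge c 2 with hc2 | hc2
      · have h0 : c - 1 = 0 := by omega
        have h1 : (c : ℝ) - 1 = 0 := by
          have : c = 1 := by omega
          subst this
          norm_num
        rw [h0, h1]; norm_num; ring
      · have e : t ^ (c - 1) = t * t ^ (c - 1 - 1) := by
          rw [← pow_succ']
          congr 1
          omega
        rw [e]
        ring
    have hpos2 : 0 < (t ^ 2 * S' - ((c : ℝ) - 1) * t * S t) * t ^ (c - 1) := mul_pos hkey (pow_pos ht0 _)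
    rw [← hnum] at hpos2
    have hnumpos : 0 < S' * t ^ (c - 1) - S t * (((c - 1 : ℕ) : ℝ) * t ^ (c - 1 - 1)) := by
      by_contra hle
      push Not at hle
      exact absurd hpos2 (not_lt.2 (mul_nonpos_of_nonpos_of_nonneg hle (pow_pos ht0 2).le))
    exact div_pos hnumpos (by positivity)
  -- R is strictly increasing on the window
  have hRcont : ContinuousOn R (Set.Icc u v) := fun t ht =>
    (hRderiv t ht).choose_spec.1.continuousAt.continuousWithinAt
  have hRmono : StrictMonoOn R (Set.Icc u v) := by
    refine strictMonoOn_of_deriv_pos (convex_Icc u v) hRcont fun t ht => ?_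
    have ht' : t ∈ Set.Icc u v := interior_subset ht
    obtain ⟨R', hR', hR'pos⟩ := hRderiv t ht'
    rwa [hR'.deriv]
  -- every critical point in the window is a zero of R
  have hzero : ∀ t ∈ Set.Icc u v, (derivative Φ).eval t = 0 → R t = 0 := by
    intro t ht hcrit
    have ht0 : 0 < t := hu.trans_le ht.1
    have hgt := hg t ht
    have hΦt : Φ.eval t ≠ 0 := by
      rw [hΦ, eval_prod]
      exact prod_ne_zero_iff.2 fun j _ => hgt j
    have h := eval_derivative_prod_rows m a c co hgt
    rw [hcrit] at h
    have hS0 : S t = 0 := (mul_eq_zero.1 h.symm).resolve_left hΦt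
    simp [hR, hS0]
  refine card_le_one.2 fun x hx y hy => ?_
  simp only [mem_filter, Multiset.mem_toFinset] at hx hy
  have hx' : x ∈ Set.Icc u v := ⟨hx.2.1, hx.2.2⟩
  have hy' : y ∈ Set.Icc u v := ⟨hy.2.1, hy.2.2⟩
  have hRx := hzero x hx' (mem_roots'.1 hx.1).2
  have hRy := hzero y hy' (mem_roots'.1 hy.1).2
  exact hRmono.injOn hx' hy' (hRx.trans hRy.symm)

/-- **Dips are separated by non-admissible points**: for a zero-free company, two distinct positive critical points `x < y` force a point
`z ∈ [x, y]` at which the strict dip criterion fails (`a(a−c)M(z) ≤ Σ_j h_j(z)²`). [folklore] -/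
theorem valley_dips_separated (m a c : ℕ) (hc : 1 ≤ c) (co : Fin m → ℝ × ℝ × ℝ)
    (hpos : ∀ j, ∀ t : ℝ, 0 < t → 0 < (row a c (co j).1 (co j).2.1 (co j).2.2).eval t) {x y : ℝ} (hx : 0 < x) (hxy : x < y)
    (hxr : x ∈ (derivative (∏ j, row a c (co j).1 (co j).2.1 (co j).2.2)).roots)
    (hyr : y ∈ (derivative (∏ j, row a c (co j).1 (co j).2.1 (co j).2.2)).roots) :
    ∃ z ∈ Set.Icc x y, (a : ℝ) * ((a : ℝ) - c) * middleSum a c co z ≤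
      ∑ j, (z * (derivative (row a c (co j).1 (co j).2.1 (co j).2.2)).eval z /
          (row a c (co j).1 (co j).2.1 (co j).2.2).eval z) ^ 2 := by
  classical
  by_contra hno
  push Not at hno
  have h1 := card_crit_Icc_le_one_of_dipAdmissible m a c hc co hx
    (fun t ht j => (hpos j t (hx.trans_le ht.1)).ne') (fun t ht => hno t ht)
  have hx2 : x ∈ ((derivative (∏ j, row a c (co j).1 (co j).2.1 (co j).2.2)).roots.toFinset).filter
      (fun t => x ≤ t ∧ t ≤ y) := by
    simp only [mem_filter, Multiset.mem_toFinset]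
    exact ⟨hxr, le_rfl, hxy.le⟩
  have hy2 : y ∈ ((derivative (∏ j, row a c (co j).1 (co j).2.1 (co j).2.2)).roots.toFinset).filter
      (fun t => x ≤ t ∧ t ≤ y) := by
    simp only [mem_filter, Multiset.mem_toFinset]
    exact ⟨hyr, hxy.le, le_rfl⟩
  have := card_le_one.1 h1 x hx2 y hy2
  exact absurd this hxy.ne

end ZeroChange

end Summit.ValiantsHypothesis.ValiantsHypothesis.Theorems.LacunarySymmetroidMatrixDescartes
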